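import Mathlib
import HarnessLib
import Summits.CriticalPhenomena.Ising3DConformalLimit.Theorems.RotationUpgradeFromTwoPoint.Negative.ContinuityFree
import Summits.CriticalPhenomena.Ising3DConformalLimit.Theorems.MoebiusLimitExists.Negative.FreeReflections
import Summits.CriticalPhenomena.Ising3DConformalLimit.Theorems.MoebiusLimitExists.Negative.FreePermutations
import Literature.Probability.LatticeModels.CriticalScalingDimension
import Literature.Probability.LatticeModels.HighDimPointwiseTriviality
import Literature.MathematicalPhysics.QuantumFieldTheory.LatticeMirrorNormals
import Literature.MathematicalPhysics.QuantumFieldTheory.MirrorRPKernel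

/-!
# The two-point kernel of a pointwise scaling limit of the critical `ℤ³` Ising correlators, I:
# window, continuity, positivity, homogeneity, hyperoctahedral invariance, and the passage of
# lattice reflection positivity to the limit
(route HyperoctahedralRP: clauses of the glue `TwoPointKernelOfLimit`, item stmt-CriticalPhenomena-1983,
on the way to the milestone `TwoPointLimitIsotropic`, item stmt-CriticalPhenomena-1984; the assembly is
in `…HyperoctahedralRPTwoPointKernelOfLimit`)

Let `S` be a pointwise scaling limit of `criticalCorr 3` (renormalisation `ρ > 0` on `(0,1]`) which is
non-degenerate and scale covariant with dimension `Δ`, and `K x = S 2 (0, x)`. This file proves: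
(a) `1/2 ≤ Δ ≤ 1` (`window`) — the tree's `scalingDimension_mem_Icc_holds` (infrared / Simon–Lieb
bounds); (b) `K` is continuous off `0` (`kernel_continuousOn`) — continuity of ANY pointwise limit
of the critical correlators on non-coincident configurations is automatic (`limit_continuousOn`:
lattice translation invariance + a pigeonhole on mesh cells); (c) `K > 0` off `0` (`kernel_pos`,
non-degeneracy); (d) `K (c x) = c^{-2Δ} K x` (`kernel_homogeneous`, scale covariance at `n = 2`);
(e) `K ∘ θ_n = K` for the nine lattice mirror normals `n ∈ {e_i, e_i ± e_j}`
(`kernel_mirror_invariant`) — the reflections are signed coordinate permutations, under which any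
limit is invariant (`limit_signedPerm`, from the tree's `limit_coordPerm`, `limit_signFlip`);
(f) the limit passage `kernel_mirrorRP_of_latticeRP`: if the critical lattice two-point function is
reflection positive for a lattice realisation `θ'` of `θ_n` on families of sites strictly inside an
integer level set `{ℓ > 0}` realising `⟨·, n⟩ > 0`, then `Σ c_a c_b K (p_a - θ_n p_b) ≥ 0` for
points of the open half-space: `K (p_a - θ p_b)` is a value `S 2 (θ p, q)` by translation
invariance of the limit (`limit_two_eq_of_sub`); approximate `p_a` by the rescaled sites `δ[p_a/δ]`,
eventually strictly inside the half-lattice, where lattice RP and `ρ(δ)² ≥ 0` give non-negative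
sums; the rescaled pair correlator converges CONTINUOUSLY (locally uniform convergence + continuity
of `S 2`, `TendstoLocallyUniformlyOn.tendsto_comp`) along `δ[θ' y] = θ (δ y) → θ p_a`;
`ge_of_tendsto`.

References: J. Glimm, A. Jaffe, *Quantum Physics* (1987), §10.4 (RP is preserved under limits);
S. Friedli, Y. Velenik (CUP 2017), Thm. 3.17, Exercise 3.14 (lattice symmetries of `⟨·⟩_β`);
A. Björner, F. Brenti, *Combinatorics of Coxeter Groups* (2005), §8.1 (the `B₃` reflections are
signed permutations); H. Duminil-Copin, *Lectures on the Ising and Potts models* (2019), Thm. 4.8.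
No definitions are introduced.
-/

noncomputable section

namespace Summit.CriticalPhenomena.Ising3DConformalLimit.HyperoctahedralRPTwoPoint

open Literature.Probability.LatticeModels Literature.MathematicalPhysics.QuantumFieldTheory
open Filter Set
open scoped Topology InnerProductSpace
open Summit.CriticalPhenomena.Ising3DConformalLimit.MoebiusLimitExistsNegative
open Summit.CriticalPhenomena.Ising3DConformalLimit.RotationUpgradeFromTwoPointNegative

variable {ρ : ℝ → ℝ} {Δ : ℝ} {S : CorrFamily 3}

/-! ### Pairs `(0, x)` -/

/-- A pair of distinct points is a non-coincident configuration. [folklore] -/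
theorem pair_mem_nonCoincident {p q : EuclideanSpace ℝ (Fin 3)} (h : p ≠ q) :
    (![p, q] : Fin 2 → EuclideanSpace ℝ (Fin 3)) ∈ NonCoincident 3 2 := by
  rw [mem_nonCoincident]
  intro i j hij
  fin_cases i <;> fin_cases j
  · rfl
  · exact absurd hij h
  · exact absurd hij.symm h
  · rfl

/-- `(0, x)` is non-coincident for `x ≠ 0`. [folklore] -/
theorem zero_pair_mem_nonCoincident {x : EuclideanSpace ℝ (Fin 3)} (hx : x ≠ 0) :
    (![0, x] : Fin 2 → EuclideanSpace ℝ (Fin 3)) ∈ NonCoincident 3 2 :=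
  pair_mem_nonCoincident (Ne.symm hx)

/-- `x ↦ (0, x)` is continuous. [folklore] -/
theorem continuous_zeroPair :
    Continuous (fun x : EuclideanSpace ℝ (Fin 3) => (![0, x] : Fin 2 → EuclideanSpace ℝ (Fin 3))) := by
  refine continuous_pi fun i => ?_
  fin_cases i
  · simpa using continuous_const
  · simpa using continuous_id'

/-- A map applied to the pair `(0, x)`, when it fixes `0`. [folklore] -/
theorem comp_zeroPair {R : EuclideanSpace ℝ (Fin 3) → EuclideanSpace ℝ (Fin 3)} (hR : R 0 = 0)
    (x : EuclideanSpace ℝ (Fin 3)) :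
    (fun i => R ((![0, x] : Fin 2 → EuclideanSpace ℝ (Fin 3)) i)) = ![0, R x] := by
  funext i
  fin_cases i
  · simpa using hR
  · simp

/-! ### Clauses (a)–(d): window, continuity, positivity, homogeneity -/

/-- (a) `1/2 ≤ Δ ≤ 1` (tree theorem `scalingDimension_mem_Icc_holds`: infrared and Simon–Lieb
bounds). [cite: DuminilCopin2019, Thm. 4.8, §4.4] -/
theorem window (hρ : ∀ δ ∈ Set.Ioc (0:ℝ) 1, 0 < ρ δ)
    (hlim : HasPointwiseScalingLimit (criticalCorr 3) ρ S) (hnd : IsNondegenerateTwoPoint S)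
    (hsc : IsScaleCovariant Δ S) : 1/2 ≤ Δ ∧ Δ ≤ 1 :=
  scalingDimension_mem_Icc_holds ρ Δ S hlim hsc hnd hρ

/-- (b) The kernel `x ↦ S 2 (0, x)` is continuous off the origin — continuity of any pointwise
limit on non-coincident configurations is automatic (`limit_continuousOn`, lattice translation
invariance + a pigeonhole on cells). [cite: FriedliVelenik2017, Thm. 3.17] -/
theorem kernel_continuousOn (hlim : HasPointwiseScalingLimit (criticalCorr 3) ρ S) :
    ContinuousOn (fun x : EuclideanSpace ℝ (Fin 3) => S 2 ![0, x]) {0}ᶜ := by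
  have h2 := limit_continuousOn hlim 2
  exact h2.comp continuous_zeroPair.continuousOn fun x hx => zero_pair_mem_nonCoincident hx

/-- (c) The kernel is positive off the origin (non-degeneracy). [folklore] -/
theorem kernel_pos (hnd : IsNondegenerateTwoPoint S) (x : EuclideanSpace ℝ (Fin 3)) (hx : x ≠ 0) :
    0 < S 2 ![0, x] :=
  hnd _ (zero_pair_mem_nonCoincident hx)

/-- (d) The kernel is homogeneous of degree `-2Δ` (scale covariance at `n = 2`). [folklore] -/
theorem kernel_homogeneous (hsc : IsScaleCovariant Δ S) (c : ℝ) (hc : 0 < c)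
    (x : EuclideanSpace ℝ (Fin 3)) :
    S 2 ![0, c • x] = c ^ (-(2 * Δ)) * S 2 ![0, x] := by
  have h := hsc 2 c hc ![0, x]
  have hcfg : (fun i => c • (![0, x] : Fin 2 → EuclideanSpace ℝ (Fin 3)) i) = ![0, c • x] :=
    comp_zeroPair (smul_zero c) x
  rw [hcfg] at h
  rw [h]
  norm_num

/-! ### Clause (e): invariance under the nine lattice mirrors (hyperoctahedral symmetry is free) -/

/-- Any pointwise limit is invariant under every signed coordinate permutation of `ℝ³`
(`(R p)_j = ε_j p_{π⁻¹ j}`) on non-coincident configurations: composite of the free coordinate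
permutations (`limit_coordPerm`) and sign flips (`limit_signFlip`).
[cite: FriedliVelenik2017, Exercise 3.14, p. 115] -/
theorem limit_signedPerm (hlim : HasPointwiseScalingLimit (criticalCorr 3) ρ S)
    (π : Equiv.Perm (Fin 3)) (ε : Fin 3 → ℤˣ)
    (R : EuclideanSpace ℝ (Fin 3) ≃ₗᵢ[ℝ] EuclideanSpace ℝ (Fin 3))
    (hR : ∀ (p : EuclideanSpace ℝ (Fin 3)) (j : Fin 3), R p j = ((ε j : ℤ) : ℝ) * p (π.symm j))
    {n : ℕ} {x : Fin n → EuclideanSpace ℝ (Fin 3)} (hx : x ∈ NonCoincident 3 n) :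
    S n (fun i => R (x i)) = S n x := by
  set P := LinearIsometryEquiv.piLpCongrLeft 2 ℝ ℝ π with hP
  set Rε : EuclideanSpace ℝ (Fin 3) ≃ₗᵢ[ℝ] EuclideanSpace ℝ (Fin 3) := P.symm.trans R with hRε
  have hPsymm : ∀ (p : EuclideanSpace ℝ (Fin 3)) (l : Fin 3), P.symm p l = p (π l) := by
    intro p l
    rw [hP, LinearIsometryEquiv.piLpCongrLeft_symm, coordPerm_apply]
    simp
  have hRε' : ∀ (p : EuclideanSpace ℝ (Fin 3)) (j : Fin 3), Rε p j = ((ε j : ℤ) : ℝ) * p j := by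
    intro p j
    rw [hRε, LinearIsometryEquiv.trans_apply, hR, hPsymm, Equiv.apply_symm_apply]
  have hPx := (map_mem_nonCoincident_iff P x).2 hx
  have h1 : (fun i => R (x i)) = fun i => Rε (P (x i)) := by
    funext i
    rw [hRε, LinearIsometryEquiv.trans_apply, LinearIsometryEquiv.symm_apply_apply]
  rw [h1, limit_signFlip hlim ε Rε hRε' hPx, limit_coordPerm hlim π hx]

/-- The reflection in each of the nine lattice mirrors `e_i`, `e_i ± e_j` is a signed coordinate
permutation. [cite: BjornerBrenti2005, §8.1, Prop. 8.1.5] -/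
theorem exists_signedPerm_of_latticeNormal {n : EuclideanSpace ℝ (Fin 3)}
    (hn : ∃ i j : Fin 3, i ≠ j ∧ (n = EuclideanSpace.single i 1 ∨
      n = EuclideanSpace.single i 1 + EuclideanSpace.single j 1 ∨
      n = EuclideanSpace.single i 1 - EuclideanSpace.single j 1)) :
    ∃ (π : Equiv.Perm (Fin 3)) (ε : Fin 3 → ℤˣ), ∀ (p : EuclideanSpace ℝ (Fin 3)) (l : Fin 3),
      ((ℝ ∙ n)ᗮ.reflection p) l = ((ε l : ℤ) : ℝ) * p (π.symm l) := by
  obtain ⟨i, j, hij, rfl | rfl | rfl⟩ := hn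
  · refine ⟨Equiv.refl _, fun l => if l = i then -1 else 1, fun p l => ?_⟩
    rw [reflection_single_apply]
    by_cases hl : l = i
    · simp [hl]
    · simp [hl]
  · refine ⟨Equiv.swap i j, fun l => if l = i ∨ l = j then -1 else 1, fun p l => ?_⟩
    rw [reflection_single_add_single_apply hij, Equiv.symm_swap]
    by_cases hli : l = i
    · subst hli
      simp [Equiv.swap_apply_left]
    · by_cases hlj : l = j
      · subst hlj
        simp [hli, Equiv.swap_apply_right]
      · simp [hli, hlj, Equiv.swap_apply_of_ne_of_ne hli hlj]
  · refine ⟨Equiv.swap i j, fun _ => 1, fun p l => ?_⟩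
    rw [reflection_single_sub_single_apply hij, Equiv.symm_swap]
    simp

/-- (e) The kernel `x ↦ S 2 (0, x)` is invariant under the nine lattice mirrors. [folklore] -/
theorem kernel_mirror_invariant (hlim : HasPointwiseScalingLimit (criticalCorr 3) ρ S)
    {n : EuclideanSpace ℝ (Fin 3)}
    (hn : ∃ i j : Fin 3, i ≠ j ∧ (n = EuclideanSpace.single i 1 ∨
      n = EuclideanSpace.single i 1 + EuclideanSpace.single j 1 ∨
      n = EuclideanSpace.single i 1 - EuclideanSpace.single j 1))
    (x : EuclideanSpace ℝ (Fin 3)) :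
    S 2 ![0, (ℝ ∙ n)ᗮ.reflection x] = S 2 ![0, x] := by
  by_cases hx : x = 0
  · subst hx
    simp
  obtain ⟨π, ε, hR⟩ := exists_signedPerm_of_latticeNormal hn
  have h := limit_signedPerm hlim π ε ((ℝ ∙ n)ᗮ.reflection) hR (zero_pair_mem_nonCoincident hx)
  rwa [comp_zeroPair (map_zero _)] at h


/-! ### Clause (f): lattice reflection positivity passes to the limit -/

/-- Floor error in norm: `‖δ·[q/δ] - q‖ ≤ 2δ` (`δ > 0`). [folklore] -/
theorem norm_smul_siteVec_latticeApprox_sub_le {δ : ℝ} (hδ : 0 < δ) (q : EuclideanSpace ℝ (Fin 3)) :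
    ‖δ • siteVec (latticeApprox δ q) - q‖ ≤ 2 * δ := by
  have hcoord : ∀ j, |(δ • siteVec (latticeApprox δ q) - q) j| ≤ δ := fun j => by
    rw [PiLp.sub_apply, PiLp.smul_apply, siteVec_apply, smul_eq_mul]
    exact abs_mul_latticeApprox_sub_le hδ q j
  rw [EuclideanSpace.norm_eq]
  have hsum : ∑ j, ‖(δ • siteVec (latticeApprox δ q) - q) j‖ ^ 2 ≤ 3 * δ ^ 2 := by
    calc ∑ j, ‖(δ • siteVec (latticeApprox δ q) - q) j‖ ^ 2 ≤ ∑ _j : Fin 3, δ ^ 2 :=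
          Finset.sum_le_sum fun j _ => by
            rw [Real.norm_eq_abs]
            exact pow_le_pow_left₀ (abs_nonneg _) (hcoord j) 2
      _ = 3 * δ ^ 2 := by simp
  rw [Real.sqrt_le_left (by positivity)]
  nlinarith

/-- `δ·[q/δ] → q` as `δ → 0⁺`. [folklore] -/
theorem tendsto_smul_siteVec_latticeApprox (q : EuclideanSpace ℝ (Fin 3)) :
    Tendsto (fun δ : ℝ => δ • siteVec (latticeApprox δ q)) (𝓝[>] (0:ℝ)) (𝓝 q) := by
  rw [tendsto_iff_norm_sub_tendsto_zero]
  have h2 : Tendsto (fun δ : ℝ => 2 * δ) (𝓝[>] (0:ℝ)) (𝓝 0) := by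
    have h : Tendsto (fun δ : ℝ => 2 * δ) (𝓝 (0:ℝ)) (𝓝 (2 * 0)) :=
      tendsto_id.const_mul 2
    rw [mul_zero] at h
    exact h.mono_left nhdsWithin_le_nhds
  refine squeeze_zero' (Eventually.of_forall fun δ => norm_nonneg _) ?_ h2
  filter_upwards [self_mem_nhdsWithin] with δ hδ
  exact norm_smul_siteVec_latticeApprox_sub_le hδ q

/-- The rescaled pair correlator at a pair of rescaled lattice sites is `ρ(δ)²` times the lattice
pair correlator (`[δu/δ] = u`). [folklore] -/
theorem rescaledCorrelator_two_smul_siteVec (ρ : ℝ → ℝ) {δ : ℝ} (hδ : 0 < δ) (u v : Site 3) :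
    rescaledCorrelator (criticalCorr 3) ρ 2 δ
        (![δ • siteVec u, δ • siteVec v] : Fin 2 → EuclideanSpace ℝ (Fin 3)) =
      ρ δ ^ 2 * criticalCorr 3 2 ![u, v] := by
  rw [rescaledCorrelator_apply, latticeApprox_comp_two]
  simp only [Matrix.cons_val_zero, Matrix.cons_val_one, Matrix.cons_val_fin_one,
    latticeApprox_smul_siteVec hδ]

/-- **Lattice mirror positivity passes to the scaling limit.** Let `n` be a normal vector,
`θ'` a map of `ℤ³` realising the mirror reflection `θ_n` on lattice sites and `ℓ` an integer
level realising `⟪·, n⟫` on lattice sites. If the critical two-point function is reflection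
positive for `θ'` on finite families of sites strictly inside `{ℓ > 0}`, then the two-point kernel
`x ↦ S 2 (0, x)` of any pointwise scaling limit `S` is mirror reflection positive for `n`:
approximate the points `p_a` by the rescaled sites `δ[p_a/δ]` (eventually strictly inside the
half-space), use `ρ(δ)² ≥ 0`, and pass to the limit `δ → 0⁺` through the (automatic) continuity
of `S 2` off the diagonal. [cite: GlimmJaffeQP1987, §10.4, Remark after Thm. 10.4.3] -/
theorem kernel_mirrorRP_of_latticeRP (hlim : HasPointwiseScalingLimit (criticalCorr 3) ρ S)
    (n : EuclideanSpace ℝ (Fin 3)) (θ' : Site 3 → Site 3) (ℓ : Site 3 → ℤ)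
    (hθ' : ∀ y, siteVec (θ' y) = (ℝ ∙ n)ᗮ.reflection (siteVec y))
    (hℓ : ∀ y, (ℓ y : ℝ) = ⟪siteVec y, n⟫_ℝ)
    (hRP : ∀ (m : ℕ) (y : Fin m → Site 3) (c : Fin m → ℝ), (∀ a, 0 < ℓ (y a)) →
      0 ≤ ∑ a, ∑ b, c a * c b * criticalCorr 3 2 ![θ' (y a), y b])
    (m : ℕ) (p : Fin m → EuclideanSpace ℝ (Fin 3)) (c : Fin m → ℝ)
    (hp : ∀ a, 0 < ⟪p a, n⟫_ℝ) :
    0 ≤ ∑ a, ∑ b, c a * c b * S 2 ![0, p a - (ℝ ∙ n)ᗮ.reflection (p b)] := by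
  set θ := (ℝ ∙ n)ᗮ.reflection with hθdef
  -- the reflected points lie strictly on the other side
  have hne : ∀ a b, θ (p a) ≠ p b := by
    intro a b h
    have h1 : ⟪θ (p a), n⟫_ℝ = -⟪p a, n⟫_ℝ := inner_mirrorReflection_normal n (p a)
    have h2 := hp a
    have h3 := hp b
    rw [h] at h1
    linarith
  -- Step 1: the target sum is `Σ c_a c_b S 2 (θ p_a, p_b)`
  have hsum : ∑ a, ∑ b, c a * c b * S 2 ![0, p a - θ (p b)] =
      ∑ a, ∑ b, c a * c b * S 2 ![θ (p a), p b] := by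
    rw [Finset.sum_comm]
    refine Finset.sum_congr rfl fun a _ => Finset.sum_congr rfl fun b _ => ?_
    rw [limit_two_eq_of_sub hlim (hne a b), mul_comm (c b) (c a)]
  rw [hsum]
  -- Step 2: the approximants and their limits
  set y : ℝ → Fin m → Site 3 := fun δ a => latticeApprox δ (p a) with hy
  set T : ℝ → Fin m → Fin m → ℝ := fun δ a b =>
    rescaledCorrelator (criticalCorr 3) ρ 2 δ
      (![δ • siteVec (θ' (y δ a)), δ • siteVec (y δ b)] : Fin 2 → EuclideanSpace ℝ (Fin 3)) with hT
  have hTlim : ∀ a b, Tendsto (fun δ => T δ a b) (𝓝[>] (0:ℝ)) (𝓝 (S 2 ![θ (p a), p b])) := by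
    intro a b
    have hmem : (![θ (p a), p b] : Fin 2 → EuclideanSpace ℝ (Fin 3)) ∈ NonCoincident 3 2 :=
      pair_mem_nonCoincident (hne a b)
    have hcont : ContinuousWithinAt (S 2) (NonCoincident 3 2) ![θ (p a), p b] :=
      limit_continuousOn hlim 2 _ hmem
    have ha : Tendsto (fun δ : ℝ => δ • siteVec (θ' (y δ a))) (𝓝[>] (0:ℝ)) (𝓝 (θ (p a))) := by
      have h1 : ∀ δ : ℝ, δ • siteVec (θ' (y δ a)) = θ (δ • siteVec (y δ a)) := fun δ => by
        rw [hθ', LinearIsometryEquiv.map_smul]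
      simp_rw [h1]
      exact (θ.continuous.tendsto _).comp (tendsto_smul_siteVec_latticeApprox (p a))
    have hb : Tendsto (fun δ : ℝ => δ • siteVec (y δ b)) (𝓝[>] (0:ℝ)) (𝓝 (p b)) :=
      tendsto_smul_siteVec_latticeApprox (p b)
    have hZ : Tendsto (fun δ : ℝ =>
        (![δ • siteVec (θ' (y δ a)), δ • siteVec (y δ b)] : Fin 2 → EuclideanSpace ℝ (Fin 3)))
        (𝓝[>] (0:ℝ)) (𝓝 ![θ (p a), p b]) := by
      rw [tendsto_pi_nhds]
      intro i
      fin_cases i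
      · simpa using ha
      · simpa using hb
    have hZ' : Tendsto (fun δ : ℝ =>
        (![δ • siteVec (θ' (y δ a)), δ • siteVec (y δ b)] : Fin 2 → EuclideanSpace ℝ (Fin 3)))
        (𝓝[>] (0:ℝ)) (𝓝[NonCoincident 3 2] ![θ (p a), p b]) :=
      tendsto_nhdsWithin_of_tendsto_nhds_of_eventually_within _ hZ
        (hZ.eventually ((isOpen_nonCoincident 3 2).mem_nhds hmem))
    exact (hlim 2).tendsto_comp hcont hmem hZ'
  -- Step 3: eventually every lattice point is strictly on the positive side
  have hpos : ∀ᶠ δ in 𝓝[>] (0:ℝ), ∀ a, 0 < ℓ (y δ a) := by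
    refine eventually_all.2 fun a => ?_
    have hcont : Continuous fun q : EuclideanSpace ℝ (Fin 3) => ⟪q, n⟫_ℝ :=
      continuous_id.inner continuous_const
    have ht : Tendsto (fun δ : ℝ => ⟪δ • siteVec (y δ a), n⟫_ℝ) (𝓝[>] (0:ℝ)) (𝓝 ⟪p a, n⟫_ℝ) :=
      (hcont.tendsto _).comp (tendsto_smul_siteVec_latticeApprox (p a))
    filter_upwards [ht.eventually (lt_mem_nhds (hp a)), self_mem_nhdsWithin] with δ hδ hδpos
    rw [real_inner_smul_left, ← hℓ] at hδ
    have h' : (0:ℝ) < ℓ (y δ a) := pos_of_mul_pos_right hδ (le_of_lt hδpos)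
    exact_mod_cast h'
  -- Step 4: eventually the approximating sums are `ρ(δ)² · (lattice RP sum) ≥ 0`
  have hTsum : ∀ᶠ δ in 𝓝[>] (0:ℝ), 0 ≤ ∑ a, ∑ b, c a * c b * T δ a b := by
    filter_upwards [hpos, self_mem_nhdsWithin] with δ hδ hδpos
    have hrw : ∑ a, ∑ b, c a * c b * T δ a b =
        ρ δ ^ 2 * ∑ a, ∑ b, c a * c b * criticalCorr 3 2 ![θ' (y δ a), y δ b] := by
      rw [Finset.mul_sum]
      refine Finset.sum_congr rfl fun a _ => ?_
      rw [Finset.mul_sum]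
      refine Finset.sum_congr rfl fun b _ => ?_
      rw [hT]
      simp only []
      rw [rescaledCorrelator_two_smul_siteVec ρ hδpos]
      ring
    rw [hrw]
    exact mul_nonneg (sq_nonneg _) (hRP m (y δ) c hδ)
  -- Step 5: pass to the limit
  have hlimsum : Tendsto (fun δ => ∑ a, ∑ b, c a * c b * T δ a b) (𝓝[>] (0:ℝ))
      (𝓝 (∑ a, ∑ b, c a * c b * S 2 ![θ (p a), p b])) :=
    tendsto_finsetSum _ fun a _ => tendsto_finsetSum _ fun b _ => (hTlim a b).const_mul _
  exact ge_of_tendsto hlimsum hTsum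


end Summit.CriticalPhenomena.Ising3DConformalLimit.HyperoctahedralRPTwoPoint

end
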